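import Summits.NavierStokesRegularity.NavierStokesRegularity.Theorems.ExtremiserTransienceLocalKatoGapPointEstimate
import HarnessLib

/-!
# The localised Kato gap for Type-I ancient mild fields (backward-cone persistence of violators)

Summits-side theorem file (kind = proof, no definitions), a symmetry-free tool for the rungs of LINE g9-β
`filament_selection` on crux stmt-NavierStokesRegularity-26567 (rung R8 `ScrewSymmetricLiouville`: file (A) of
the R8 plan; consumed together with the near-axis blow-down lemma). Parts I–II:
`ExtremiserTransienceLocalKatoGapKernel.lean`, `ExtremiserTransienceLocalKatoGapPointEstimate.lean`.

For the Type-I ancient mild class `A_C = IsTypeIAncientMild C` (KNSS/Oseen gauge, unit viscosity,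
`‖u(t,x)‖ ≤ C/√(−t)`; NO symmetry) we prove: there is an absolute `ε₁ > 0` such that for every `C` and every
`0 < ε ≤ ε₁` there are `N > 2` and `ρ > 0` with the following property. If `u ∈ A_C`, `t₀ < 0`, `x₀ ∈ ℝ³`, and
the scale-invariant size is small on the EARLIER space–time cylinder,
`√(−σ)‖u(σ,z)‖ ≤ ε` for `N²t₀ ≤ σ ≤ 4t₀`, `‖z − x₀‖ ≤ ρ√(−t₀)`,
then it is twice as small on the LATER cylinder:
`√(−τ)‖u(τ,y)‖ ≤ ε/2` for `4t₀ ≤ τ ≤ t₀`, `‖y − x₀‖ ≤ ρ√(−t₀)/4` (`localKatoGap`).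

Contrapositive (the form the screw-symmetric Liouville argument iterates): an `ε`-violator
`√(−t₀)‖u(t₀,x₀)‖ > ε` forces an `ε`-violator `(σ, z)` with `N²t₀ ≤ σ ≤ 4t₀` and `‖z − x₀‖ ≤ ρ√(−t₀)`
(`exists_earlier_violator`); iterating, violators persist towards `t = −∞` inside a backward paraboloid
`‖x − x₀‖ ≤ ρ√(−t)` (`exists_violator_before`).

Proof (a localised version of the small-data gap `√(−t)‖u‖_∞ ≤ ε₀ ⇒ u ≡ 0`). Write `a = √(−t₀)`. By the
ANCIENT OSEEN INEQUALITY of the tree (`SymmetryModuliCountSymmetricLiouville.stub_ancientOseenBound`, no free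
term), `‖u(τ,y)‖ ≤ C₀∫_{σ<τ}∫(τ−σ+‖y−z‖²)^{-2}‖u(σ,z)‖² dz dσ`. For `τ ∈ [4t₀, t₀]` and `y` in the affinely
shrinking zone `‖y − x₀‖ ≤ R(τ) = ρa/2 − v(τ − 4t₀)`, `v = ρ/(12a)`, the sources are split into: old times
`σ < N²t₀` (Type-I bound only; `≤ 2√2c₃C²/(Na)`), the hypothesis cylinder (`≤ ε²A/a` by the tree's kernel/time
weight integral `stub_kernelTimeWeightIntegral`), its exterior at times `[N²t₀,4t₀]` (distance `≥ ρa/2`;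
`≤ 2c₃C²N²/(ρa)`), the zone at times `[4t₀, τ)` where the bootstrap bound `‖u‖ ≤ η = ε/(2a)` is available
(`≤ 2c₃η²·2a`), and the exterior of the zone at those times (distance `≥ v(τ−σ)` by the affine shrinking,
kernel comparison `(θ+v²θ²)^{-1/2} ≤ (2v)^{-1/2}θ^{-3/4}`; `≤ 32√6·c₃C²/(√ρ·a)`). With `ε₁ = 1/(16C₀(A+c₃)+1)`,
`N = 48C₀c₃C²/ε + 3` and `ρ` polynomially large the total is `≤ ε/(4a) = η/2`, and a continuous induction in
`τ` (tube lemma over the compact zone, joint continuity of `u`) carries the bound `‖u‖ ≤ η` on the zone from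
`τ = 4t₀` (where it is the hypothesis) up to `τ = t₀`.

References: Koch–Nadirashvili–Seregin–Šverák, Acta Math. 203 (2009) = arXiv:0709.3599, §4 ((3.8), (4.3)–(4.4)),
§5 (Thm 5.1); Koch–Tataru, Adv. Math. 157 (2001), (14).
-/

noncomputable section

set_option linter.dupNamespace false

open Set Function Filter MeasureTheory Metric
open scoped Topology ENNReal NNReal
open Literature.Analysis Literature.Analysis.FluidPDE
open Summit.NavierStokesRegularity.NavierStokesRegularity.Theorems.SymmetryModuliCountSymmetricLiouville

namespace Summit.NavierStokesRegularity.NavierStokesRegularity.Theorems.NearExtremalTransiencePerFlow.LocalKatoGap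


/-! ## The choice of constants -/

set_option maxHeartbeats 400000 in
/-- **Arithmetic of the constants.** With `ε ≤ 1/(16C₀(A+c)+1)`, `N = 48C₀cC²/ε + 3` and
`ρ = 32C₀cC²N²/ε + (1536C₀cC²/ε)² + 1`, the five terms of `pointEstimate` (with `η = ε/(2a)`) sum to at most
`ε/(4a)`: each of the four groups is `≤ ε/(16a)`. -/
theorem constants_bound {C₀ A c C ε a N ρ : ℝ} (hC₀ : 0 < C₀) (hA : 0 < A) (hc : 0 < c) (hε : 0 < ε)
    (ha : 0 < a) (hε₁ : ε ≤ 1 / (16 * C₀ * (A + c) + 1)) (hN : N = 48 * C₀ * c * C ^ 2 / ε + 3)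
    (hρ : ρ = 32 * C₀ * c * C ^ 2 * N ^ 2 / ε + (1536 * C₀ * c * C ^ 2 / ε) ^ 2 + 1) :
    C₀ * (2 * Real.sqrt 2 * c * C ^ 2 / (N * a) + ε ^ 2 * A / a +
      2 * c * C ^ 2 * N ^ 2 / (ρ * a) + 4 * c * (ε / (2 * a)) ^ 2 * a +
      32 * Real.sqrt 6 * c * C ^ 2 / (Real.sqrt ρ * a)) ≤ ε / (4 * a) := by
  have hs2 : Real.sqrt 2 ≤ 3 / 2 := by
    rw [show (3 / 2 : ℝ) = Real.sqrt ((3 / 2) ^ 2) by rw [Real.sqrt_sq (by norm_num)]]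
    exact Real.sqrt_le_sqrt (by norm_num)
  have hs6 : Real.sqrt 6 ≤ 3 := by
    rw [show (3 : ℝ) = Real.sqrt (3 ^ 2) by rw [Real.sqrt_sq (by norm_num)]]
    exact Real.sqrt_le_sqrt (by norm_num)
  set M : ℝ := C₀ * c * C ^ 2 with hM
  have hM0 : 0 ≤ M := by positivity
  have hNM : N = 48 * M / ε + 3 := by rw [hN, hM]; ring
  have hN0 : 0 < N := by rw [hNM]; positivity
  set Q : ℝ := 1536 * M / ε with hQ
  set P : ℝ := 32 * M * N ^ 2 / ε with hP
  have hQ0 : 0 ≤ Q := by positivity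
  have hP0 : 0 ≤ P := by positivity
  have hρPQ : ρ = P + Q ^ 2 + 1 := by rw [hρ, hP, hQ, hM]; ring
  have hρ0 : 0 < ρ := by rw [hρPQ]; positivity
  have hsρ0 : 0 < Real.sqrt ρ := Real.sqrt_pos.2 hρ0
  have hρP : P ≤ ρ := by rw [hρPQ]; nlinarith
  have hQρ : Q ≤ Real.sqrt ρ := by
    calc Q = Real.sqrt (Q ^ 2) := (Real.sqrt_sq hQ0).symm
      _ ≤ Real.sqrt ρ := Real.sqrt_le_sqrt (by rw [hρPQ]; linarith)
  -- (1) old times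
  have e1 : 2 * Real.sqrt 2 * M / N ≤ ε / 16 := by
    rw [div_le_div_iff₀ hN0 (by norm_num)]
    have h48 : 48 * M ≤ N * ε := by
      have : 48 * M / ε ≤ N := by rw [hNM]; linarith
      rwa [div_le_iff₀ hε] at this
    nlinarith
  -- (2) the two `ε²` terms
  have e2 : C₀ * ε ^ 2 * A + C₀ * c * ε ^ 2 ≤ ε / 16 := by
    have hk : C₀ * (A + c) * ε ≤ 1 / 16 := by
      have h1 : C₀ * (A + c) * ε ≤ C₀ * (A + c) * (1 / (16 * C₀ * (A + c) + 1)) :=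
        mul_le_mul_of_nonneg_left hε₁ (by positivity)
      have h2 : C₀ * (A + c) * (1 / (16 * C₀ * (A + c) + 1)) ≤ 1 / 16 := by
        rw [mul_one_div, div_le_div_iff₀ (by positivity) (by norm_num)]
        nlinarith [mul_pos hC₀ (add_pos hA hc)]
      exact h1.trans h2
    calc C₀ * ε ^ 2 * A + C₀ * c * ε ^ 2 = (C₀ * (A + c) * ε) * ε := by ring
      _ ≤ (1 / 16) * ε := mul_le_mul_of_nonneg_right hk hε.le
      _ = ε / 16 := by ring
  -- (3) exterior of the hypothesis ball
  have e3 : 2 * M * N ^ 2 / ρ ≤ ε / 16 := by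
    rw [div_le_div_iff₀ hρ0 (by norm_num)]
    have h32 : 32 * M * N ^ 2 ≤ ρ * ε := by
      have : 32 * M * N ^ 2 / ε ≤ ρ := hρP
      rwa [div_le_iff₀ hε] at this
    nlinarith
  -- (4) exterior of the zone
  have e4 : 32 * Real.sqrt 6 * M / Real.sqrt ρ ≤ ε / 16 := by
    rw [div_le_div_iff₀ hsρ0 (by norm_num)]
    have h1536 : 1536 * M ≤ Real.sqrt ρ * ε := by
      have : 1536 * M / ε ≤ Real.sqrt ρ := hQρ
      rwa [div_le_iff₀ hε] at this
    nlinarith [mul_le_mul_of_nonneg_right hs6 hM0]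
  -- assemble (factor `1/a`)
  have hNa : N * a ≠ 0 := by positivity
  have hρa : ρ * a ≠ 0 := by positivity
  have hsρa : Real.sqrt ρ * a ≠ 0 := by positivity
  have key : C₀ * (2 * Real.sqrt 2 * c * C ^ 2 / (N * a) + ε ^ 2 * A / a +
      2 * c * C ^ 2 * N ^ 2 / (ρ * a) + 4 * c * (ε / (2 * a)) ^ 2 * a +
      32 * Real.sqrt 6 * c * C ^ 2 / (Real.sqrt ρ * a)) =
      (2 * Real.sqrt 2 * M / N + (C₀ * ε ^ 2 * A + C₀ * c * ε ^ 2) + 2 * M * N ^ 2 / ρ +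
        32 * Real.sqrt 6 * M / Real.sqrt ρ) / a := by
    rw [hM]
    field_simp
    ring
  rw [key, div_le_div_iff₀ ha (by positivity)]
  nlinarith [e1, e2, e3, e4]

/-! ## The continuous induction on the shrinking zone -/

/-- **Continuous induction in time over a shrinking family of balls.** Let `u` be jointly continuous on
`(−∞,0) × ℝ³`, `s₀ ≤ t₀ < 0`, `η > 0`, `R` antitone. If `‖u(s₀,·)‖ ≤ η` on the ball `‖z − x₀‖ ≤ R(s₀)`, and
for every `τ ∈ [s₀,t₀]` the bound `‖u‖ ≤ η` on the balls at all earlier times `σ ∈ [s₀, τ)` implies the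
IMPROVED bound `‖u(τ,·)‖ ≤ η/2` on the ball at time `τ`, then the improved bound holds at every
`τ ∈ [s₀, t₀]` (closedness from the improvement itself, openness to the right from the tube lemma over the
compact ball). -/
theorem zone_induction {u : ℝ → EuclideanSpace ℝ (Fin 3) → EuclideanSpace ℝ (Fin 3)} {x₀ : EuclideanSpace ℝ (Fin 3)} {s₀ t₀ η : ℝ} {R : ℝ → ℝ}
    (hcont : ContinuousOn (uncurry u) (Iio 0 ×ˢ univ)) (ht₀ : t₀ < 0) (hs₀ : s₀ ≤ t₀) (hη : 0 < η)
    (hR : ∀ σ σ', σ ≤ σ' → R σ' ≤ R σ)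
    (hbase : ∀ z : EuclideanSpace ℝ (Fin 3), ‖z - x₀‖ ≤ R s₀ → ‖u s₀ z‖ ≤ η)
    (hKE : ∀ τ, s₀ ≤ τ → τ ≤ t₀ →
      (∀ σ, s₀ ≤ σ → σ < τ → ∀ z : EuclideanSpace ℝ (Fin 3), ‖z - x₀‖ ≤ R σ → ‖u σ z‖ ≤ η) →
      ∀ y : EuclideanSpace ℝ (Fin 3), ‖y - x₀‖ ≤ R τ → ‖u τ y‖ ≤ η / 2) :
    ∀ τ, s₀ ≤ τ → τ ≤ t₀ → ∀ y : EuclideanSpace ℝ (Fin 3), ‖y - x₀‖ ≤ R τ → ‖u τ y‖ ≤ η / 2 := by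
  -- the induction set
  set S : Set ℝ := {τ | τ ∈ Icc s₀ t₀ ∧ ∀ σ, s₀ ≤ σ → σ ≤ τ → ∀ z : EuclideanSpace ℝ (Fin 3), ‖z - x₀‖ ≤ R σ → ‖u σ z‖ ≤ η}
    with hS
  -- improved bound at every point of `S`
  have himp : ∀ τ ∈ S, ∀ y : EuclideanSpace ℝ (Fin 3), ‖y - x₀‖ ≤ R τ → ‖u τ y‖ ≤ η / 2 := fun τ hτ =>
    hKE τ hτ.1.1 hτ.1.2 (fun σ h1 h2 => hτ.2 σ h1 h2.le)
  -- `S` is closed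
  have hclosed : IsClosed S := by
    refine isClosed_of_closure_subset fun τ hτ => ?_
    have hτI : τ ∈ Icc s₀ t₀ :=
      closure_minimal (fun σ (hσ : σ ∈ S) => hσ.1) isClosed_Icc hτ
    -- the bound at all earlier times
    have hearly : ∀ σ, s₀ ≤ σ → σ < τ → ∀ z : EuclideanSpace ℝ (Fin 3), ‖z - x₀‖ ≤ R σ → ‖u σ z‖ ≤ η := by
      intro σ h1 h2 z hz
      obtain ⟨τ', hτ'S, hdist⟩ := Metric.mem_closure_iff.1 hτ (τ - σ) (by linarith)
      have hστ' : σ ≤ τ' := by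
        rw [Real.dist_eq] at hdist
        have := (abs_lt.1 hdist).2
        linarith [(abs_lt.1 hdist).1]
      exact hτ'S.2 σ h1 hστ' z hz
    refine ⟨hτI, fun σ h1 h2 z hz => ?_⟩
    rcases lt_or_eq_of_le h2 with h | h
    · exact hearly σ h1 h z hz
    · subst h
      exact (hKE σ hτI.1 hτI.2 hearly z hz).trans (by linarith)
  -- base
  have hbaseS : s₀ ∈ S := by
    refine ⟨⟨le_rfl, hs₀⟩, fun σ h1 h2 z hz => ?_⟩
    obtain rfl : σ = s₀ := le_antisymm h2 h1
    exact hbase z hz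
  -- openness to the right
  have hright : ∀ τ ∈ S ∩ Ico s₀ t₀, S ∈ 𝓝[>] τ := by
    rintro τ ⟨hτS, hτ₁, hτ₂⟩
    have hτ0 : τ < 0 := lt_of_lt_of_le hτ₂ ht₀.le
    -- tube lemma over the compact ball at time `τ`
    have hK : IsCompact {z : EuclideanSpace ℝ (Fin 3) | ‖z - x₀‖ ≤ R τ} := by
      have : {z : EuclideanSpace ℝ (Fin 3) | ‖z - x₀‖ ≤ R τ} = Metric.closedBall x₀ (R τ) := by
        ext z; simp [dist_eq_norm]
      rw [this]
      exact isCompact_closedBall _ _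
    have hP : ∀ z ∈ {z : EuclideanSpace ℝ (Fin 3) | ‖z - x₀‖ ≤ R τ}, ∀ᶠ p : ℝ × EuclideanSpace ℝ (Fin 3) in 𝓝 (τ, z), ‖u p.1 p.2‖ < η := by
      intro z hz
      have hlt : ‖u τ z‖ < η := lt_of_le_of_lt (himp τ hτS z hz) (by linarith)
      have hca : ContinuousAt (uncurry u) (τ, z) :=
        hcont.continuousAt ((isOpen_Iio.prod isOpen_univ).mem_nhds ⟨hτ0, mem_univ _⟩)
      have hev := (hca.norm.eventually (gt_mem_nhds hlt))
      exact hev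
    have hev := hK.eventually_forall_of_forall_eventually (P := fun σ z => ‖u σ z‖ < η) hP
    obtain ⟨δ, hδ, hball⟩ := Metric.eventually_nhds_iff.1 hev
    refine mem_nhdsGT_iff_exists_Ioo_subset.2 ⟨min (τ + δ) t₀, lt_min (by linarith) hτ₂, ?_⟩
    intro τ' hτ'
    have hτ'1 : τ < τ' := hτ'.1
    have hτ'2 : τ' < min (τ + δ) t₀ := hτ'.2
    have hτ'δ : τ' < τ + δ := lt_of_lt_of_le hτ'2 (min_le_left _ _)
    have hτ't : τ' < t₀ := lt_of_lt_of_le hτ'2 (min_le_right _ _)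
    refine ⟨⟨by linarith, hτ't.le⟩, fun σ h1 h2 z hz => ?_⟩
    rcases le_or_gt σ τ with h | h
    · exact hτS.2 σ h1 h z hz
    · have hσd : dist σ τ < δ := by
        rw [Real.dist_eq, abs_lt]; constructor <;> linarith
      have hzτ : ‖z - x₀‖ ≤ R τ := hz.trans (hR τ σ h.le)
      exact (hball hσd z hzτ).le
  -- continuous induction
  have hsub : Icc s₀ t₀ ⊆ S :=
    IsClosed.Icc_subset_of_forall_mem_nhdsWithin
      (by rw [inter_eq_left.2 (fun τ (hτ : τ ∈ S) => hτ.1)]; exact hclosed) hbaseS hright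
  intro τ h1 h2 y hy
  exact himp τ (hsub ⟨h1, h2⟩) y hy

/-! ## The localised Kato gap -/

/-- **THE LOCALISED KATO GAP** (backward-cone persistence of `ε`-violators; symmetry-free).
There is an absolute `ε₁ > 0` such that for all `C` and `0 < ε ≤ ε₁` there are `N > 2`, `ρ > 0` with: for every
Type-I ancient mild field `u ∈ A_C` (`IsTypeIAncientMild C u`), every `t₀ < 0` and `x₀ ∈ ℝ³`, smallness
`√(−σ)‖u(σ,z)‖ ≤ ε` of the scale-invariant size on the EARLIER cylinder `N²t₀ ≤ σ ≤ 4t₀`,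
`‖z − x₀‖ ≤ ρ√(−t₀)` implies `√(−τ)‖u(τ,y)‖ ≤ ε/2` on the LATER cylinder `4t₀ ≤ τ ≤ t₀`,
`‖y − x₀‖ ≤ ρ√(−t₀)/4`. [cite: KochNadirashviliSereginSverak2009, §4 (3.8), (4.3)–(4.4); Thm 5.1 (arXiv:0709.3599 pp. 8–10)] -/
theorem localKatoGap :
    ∃ ε₁ : ℝ, 0 < ε₁ ∧ ∀ (C ε : ℝ), 0 < ε → ε ≤ ε₁ →
      ∃ N ρ : ℝ, 2 < N ∧ 0 < ρ ∧ ∀ (u : ℝ → EuclideanSpace ℝ (Fin 3) → EuclideanSpace ℝ (Fin 3)), IsTypeIAncientMild C u →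
        ∀ (t₀ : ℝ), t₀ < 0 → ∀ (x₀ : EuclideanSpace ℝ (Fin 3)),
          (∀ σ : ℝ, N ^ 2 * t₀ ≤ σ → σ ≤ 4 * t₀ → ∀ z : EuclideanSpace ℝ (Fin 3), ‖z - x₀‖ ≤ ρ * Real.sqrt (-t₀) →
              Real.sqrt (-σ) * ‖u σ z‖ ≤ ε) →
          ∀ τ : ℝ, 4 * t₀ ≤ τ → τ ≤ t₀ → ∀ y : EuclideanSpace ℝ (Fin 3), ‖y - x₀‖ ≤ ρ * Real.sqrt (-t₀) / 4 →
            Real.sqrt (-τ) * ‖u τ y‖ ≤ ε / 2 := by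
  obtain ⟨C₀, hC₀, hOseen⟩ := stub_ancientOseenBound
  obtain ⟨A, hA, hT2⟩ := stub_kernelTimeWeightIntegral
  have hc₃ : 0 < (∫ v : EuclideanSpace ℝ (Fin 3), (1 + ‖v‖ ^ 2) ^ (-(2 : ℝ))) := c₃_pos
  refine ⟨1 / (16 * C₀ * (A + (∫ v : EuclideanSpace ℝ (Fin 3), (1 + ‖v‖ ^ 2) ^ (-(2 : ℝ)))) + 1), by positivity, fun C ε hε hε₁ => ?_⟩
  set N : ℝ := 48 * C₀ * (∫ v : EuclideanSpace ℝ (Fin 3), (1 + ‖v‖ ^ 2) ^ (-(2 : ℝ))) * C ^ 2 / ε + 3 with hN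
  set ρ : ℝ := 32 * C₀ * (∫ v : EuclideanSpace ℝ (Fin 3), (1 + ‖v‖ ^ 2) ^ (-(2 : ℝ))) * C ^ 2 * N ^ 2 / ε + (1536 * C₀ * (∫ v : EuclideanSpace ℝ (Fin 3), (1 + ‖v‖ ^ 2) ^ (-(2 : ℝ))) * C ^ 2 / ε) ^ 2 + 1 with hρ
  have hN3 : 3 ≤ N := by rw [hN]; linarith [show 0 ≤ 48 * C₀ * (∫ v : EuclideanSpace ℝ (Fin 3), (1 + ‖v‖ ^ 2) ^ (-(2 : ℝ))) * C ^ 2 / ε by positivity]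
  have hρ0 : 0 < ρ := by rw [hρ]; positivity
  refine ⟨N, ρ, by linarith, hρ0, fun u hu t₀ ht₀ x₀ hhyp τ hτ₁ hτ₂ y hy => ?_⟩
  have hC : 0 ≤ C := hu.nonneg
  -- the scale `a = √(−t₀)` and the bootstrap level `η = ε/(2a)`
  set a : ℝ := Real.sqrt (-t₀) with ha
  have ha0 : 0 < a := Real.sqrt_pos.2 (by linarith)
  have ha2 : a ^ 2 = -t₀ := Real.sq_sqrt (by linarith)
  set η : ℝ := ε / (2 * a) with hη
  have hη0 : 0 < η := by positivity
  have ht₀a : t₀ = -a ^ 2 := by linarith [ha2]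
  have hN2 : (4 : ℝ) ≤ N ^ 2 := by nlinarith
  -- the zone radius
  set R : ℝ → ℝ := fun σ => ρ * a / 2 - ρ / (12 * a) * (σ + 4 * a ^ 2) with hR
  have hRanti : ∀ σ σ', σ ≤ σ' → R σ' ≤ R σ := by
    intro σ σ' h
    simp only [hR]
    have : 0 ≤ ρ / (12 * a) := by positivity
    nlinarith
  -- the smallness hypothesis in squared form
  have hhyp' : ∀ σ, -(N ^ 2 * a ^ 2) ≤ σ → σ < -(4 * a ^ 2) → ∀ z : EuclideanSpace ℝ (Fin 3), ‖z - x₀‖ ≤ ρ * a →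
      ‖u σ z‖ ^ 2 ≤ ε ^ 2 * (-σ)⁻¹ := by
    intro σ h1 h2 z hz
    have hσ0 : 0 < -σ := by nlinarith
    have hs : 0 < Real.sqrt (-σ) := Real.sqrt_pos.2 hσ0
    have h := hhyp σ (by rw [ht₀a]; linarith) (by rw [ht₀a]; linarith) z hz
    have hle : ‖u σ z‖ ≤ ε / Real.sqrt (-σ) := by
      rw [le_div_iff₀ hs, mul_comm]; exact h
    calc ‖u σ z‖ ^ 2 ≤ (ε / Real.sqrt (-σ)) ^ 2 := pow_le_pow_left₀ (norm_nonneg _) hle 2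
      _ = ε ^ 2 * (-σ)⁻¹ := by rw [div_pow, Real.sq_sqrt hσ0.le]; ring
  -- the key estimate: earlier bounds `≤ η` on the zone improve to `≤ η/2`
  have hKE : ∀ τ', -(4 * a ^ 2) ≤ τ' → τ' ≤ -a ^ 2 →
      (∀ σ, -(4 * a ^ 2) ≤ σ → σ < τ' → ∀ z : EuclideanSpace ℝ (Fin 3), ‖z - x₀‖ ≤ R σ → ‖u σ z‖ ≤ η) →
      ∀ y' : EuclideanSpace ℝ (Fin 3), ‖y' - x₀‖ ≤ R τ' → ‖u τ' y'‖ ≤ η / 2 := by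
    intro τ' h1 h2 hboot y' hy'
    have hpe := pointEstimate (ε := ε) hC₀ hA hC ha0 hN3 hρ0 (fun t ht x => hOseen C u hu t ht x) hT2
      (fun σ hσ z => hu.norm_le hσ z) h1 h2 hy' hhyp' hboot
    have hcb := constants_bound (C := C) hC₀ hA hc₃ hε ha0 hε₁ hN hρ
    have e : η / 2 = ε / (4 * a) := by rw [hη]; field_simp; ring
    rw [e]
    exact hpe.trans (le_of_eq_of_le (by rw [hη]) hcb)
  -- base of the induction: at `σ = 4t₀` the zone lies in the hypothesis ball
  have hbase : ∀ z : EuclideanSpace ℝ (Fin 3), ‖z - x₀‖ ≤ R (-(4 * a ^ 2)) → ‖u (-(4 * a ^ 2)) z‖ ≤ η := by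
    intro z hz
    have hRz : R (-(4 * a ^ 2)) = ρ * a / 2 := by simp only [hR]; ring
    have hz' : ‖z - x₀‖ ≤ ρ * a := by rw [hRz] at hz; linarith [mul_pos hρ0 ha0]
    have h := hhyp (-(4 * a ^ 2))
      (by rw [ht₀a]; nlinarith [mul_le_mul_of_nonneg_right hN2 (sq_nonneg a)])
      (by rw [ht₀a]; linarith) z hz'
    have hs4 : Real.sqrt (-(-(4 * a ^ 2))) = 2 * a := by
      rw [neg_neg, show (4 : ℝ) * a ^ 2 = (2 * a) ^ 2 by ring, Real.sqrt_sq (by positivity)]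
    rw [hs4] at h
    rw [hη, le_div_iff₀ (by positivity)]
    linarith
  -- run the induction up to `t₀ = -a²`
  have hind := zone_induction hu.continuousOn_uncurry (by nlinarith [ha0] : -a ^ 2 < 0)
    (by nlinarith : -(4 * a ^ 2) ≤ -a ^ 2) hη0 hRanti hbase hKE
  -- conclude at `(τ, y)`
  have hτ₁' : -(4 * a ^ 2) ≤ τ := by rw [ha2]; linarith
  have hτ₂' : τ ≤ -a ^ 2 := by rw [ha2]; linarith
  have hyR : ‖y - x₀‖ ≤ R τ := by
    have hRt : ρ * a / 4 ≤ R τ := by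
      have := hRanti τ (-a ^ 2) hτ₂'
      have e : R (-a ^ 2) = ρ * a / 4 := by
        simp only [hR]
        rw [show -a ^ 2 + 4 * a ^ 2 = 3 * a ^ 2 by ring, div_mul_eq_mul_div,
          show ρ * (3 * a ^ 2) = (ρ * a / 4) * (12 * a) by ring, mul_div_cancel_right₀ _ (by positivity)]
        ring
      linarith
    exact (by simpa [ha] using hy : ‖y - x₀‖ ≤ ρ * a / 4).trans hRt
  have hu2 := hind τ hτ₁' hτ₂' y hyR
  have hsτ : Real.sqrt (-τ) ≤ 2 * a := by
    rw [show 2 * a = Real.sqrt ((2 * a) ^ 2) by rw [Real.sqrt_sq (by positivity)]]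
    exact Real.sqrt_le_sqrt (by nlinarith)
  calc Real.sqrt (-τ) * ‖u τ y‖ ≤ (2 * a) * (η / 2) :=
        mul_le_mul hsτ hu2 (norm_nonneg _) (by positivity)
    _ = ε / 2 := by rw [hη]; field_simp

/-- **Contrapositive form: violators have earlier violators nearby.** With the constants of `localKatoGap`:
if `√(−t₀)‖u(t₀,x₀)‖ > ε/2`… more precisely, if the scale-invariant size EXCEEDS `ε` at `(t₀, x₀)` — or merely
exceeds `ε/2` — then it exceeds `ε` at some `(σ, z)` with `N²t₀ ≤ σ ≤ 4t₀` and `‖z − x₀‖ ≤ ρ√(−t₀)`. -/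
theorem exists_earlier_violator :
    ∃ ε₁ : ℝ, 0 < ε₁ ∧ ∀ (C ε : ℝ), 0 < ε → ε ≤ ε₁ →
      ∃ N ρ : ℝ, 2 < N ∧ 0 < ρ ∧ ∀ (u : ℝ → EuclideanSpace ℝ (Fin 3) → EuclideanSpace ℝ (Fin 3)), IsTypeIAncientMild C u →
        ∀ (t₀ : ℝ), t₀ < 0 → ∀ (x₀ : EuclideanSpace ℝ (Fin 3)), ε / 2 < Real.sqrt (-t₀) * ‖u t₀ x₀‖ →
          ∃ σ : ℝ, N ^ 2 * t₀ ≤ σ ∧ σ ≤ 4 * t₀ ∧ ∃ z : EuclideanSpace ℝ (Fin 3), ‖z - x₀‖ ≤ ρ * Real.sqrt (-t₀) ∧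
            ε < Real.sqrt (-σ) * ‖u σ z‖ := by
  obtain ⟨ε₁, hε₁, h⟩ := localKatoGap
  refine ⟨ε₁, hε₁, fun C ε hε hεε₁ => ?_⟩
  obtain ⟨N, ρ, hN, hρ, hmain⟩ := h C ε hε hεε₁
  refine ⟨N, ρ, hN, hρ, fun u hu t₀ ht₀ x₀ hviol => ?_⟩
  by_contra hcon
  push Not at hcon
  have hsmall : ∀ σ : ℝ, N ^ 2 * t₀ ≤ σ → σ ≤ 4 * t₀ → ∀ z : EuclideanSpace ℝ (Fin 3), ‖z - x₀‖ ≤ ρ * Real.sqrt (-t₀) →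
      Real.sqrt (-σ) * ‖u σ z‖ ≤ ε := fun σ h1 h2 z hz => hcon σ h1 h2 z hz
  have hlt := hmain u hu t₀ ht₀ x₀ hsmall t₀ (by linarith) le_rfl x₀
    (by rw [sub_self, norm_zero]; positivity)
  linarith

/-- **Violators persist towards `t = −∞` inside a backward paraboloid** (iteration of `exists_earlier_violator`).
With `ε₁` as above: for all `C` and `0 < ε ≤ ε₁` there is `ρ > 0` such that for every `u ∈ A_C`, every
STRONG `ε`-violator `(t₀, x₀)` (`√(−t₀)‖u(t₀,x₀)‖ > ε`) and every `T`, there is an `ε`-violator `(t, x)` with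
`t ≤ T`, `t ≤ t₀` and `‖x − x₀‖ ≤ ρ√(−t)` — at each step the time recedes by a factor `≥ 4` while the point moves by
at most `ρ√(−t)`, and `2ρ√(−t) ≤ ρ√(−4t)` keeps the displacement inside the paraboloid. -/
theorem exists_violator_before :
    ∃ ε₁ : ℝ, 0 < ε₁ ∧ ∀ (C ε : ℝ), 0 < ε → ε ≤ ε₁ →
      ∃ ρ : ℝ, 0 < ρ ∧ ∀ (u : ℝ → EuclideanSpace ℝ (Fin 3) → EuclideanSpace ℝ (Fin 3)), IsTypeIAncientMild C u →
        ∀ (t₀ : ℝ), t₀ < 0 → ∀ (x₀ : EuclideanSpace ℝ (Fin 3)), ε < Real.sqrt (-t₀) * ‖u t₀ x₀‖ →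
          ∀ T : ℝ, ∃ t : ℝ, t ≤ T ∧ t ≤ t₀ ∧ ∃ x : EuclideanSpace ℝ (Fin 3),
            ‖x - x₀‖ ≤ ρ * Real.sqrt (-t) ∧ ε < Real.sqrt (-t) * ‖u t x‖ := by
  obtain ⟨ε₁, hε₁, h⟩ := exists_earlier_violator
  refine ⟨ε₁, hε₁, fun C ε hε hεε₁ => ?_⟩
  obtain ⟨N, ρ, hN, hρ, hstep⟩ := h C ε hε hεε₁
  refine ⟨ρ, hρ, fun u hu t₀ ht₀ x₀ hviol T => ?_⟩
  -- `k`-fold iteration: a violator at a time `≤ 4^k t₀` inside the paraboloid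
  have hiter : ∀ k : ℕ, ∃ t : ℝ, t ≤ 4 ^ k * t₀ ∧ t ≤ t₀ ∧ ∃ x : EuclideanSpace ℝ (Fin 3),
      ‖x - x₀‖ ≤ ρ * Real.sqrt (-t) ∧ ε < Real.sqrt (-t) * ‖u t x‖ := by
    intro k
    induction k with
    | zero =>
      refine ⟨t₀, by simp, le_rfl, x₀, ?_, hviol⟩
      rw [sub_self, norm_zero]; positivity
    | succ k ih =>
      obtain ⟨t, ht4, htt₀, x, hx, hv⟩ := ih
      have ht0 : t < 0 := lt_of_le_of_lt htt₀ ht₀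
      have hweak : ε / 2 < Real.sqrt (-t) * ‖u t x‖ := by linarith
      obtain ⟨σ, hσ1, hσ2, z, hz, hvz⟩ := hstep u hu t ht0 x hweak
      have hσt : σ ≤ 4 * t := hσ2
      refine ⟨σ, ?_, by linarith, z, ?_, hvz⟩
      · calc σ ≤ 4 * t := hσt
          _ ≤ 4 * (4 ^ k * t₀) := by linarith
          _ = 4 ^ (k + 1) * t₀ := by ring
      · -- `‖z − x₀‖ ≤ ‖z − x‖ + ‖x − x₀‖ ≤ 2ρ√(−t) ≤ ρ√(−σ)`
        have hsq : 2 * Real.sqrt (-t) ≤ Real.sqrt (-σ) := by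
          rw [show 2 * Real.sqrt (-t) = Real.sqrt (2 ^ 2 * -t) by
            rw [Real.sqrt_mul (by norm_num), Real.sqrt_sq (by norm_num)]]
          exact Real.sqrt_le_sqrt (by linarith)
        calc ‖z - x₀‖ = ‖(z - x) + (x - x₀)‖ := by congr 1; abel
          _ ≤ ‖z - x‖ + ‖x - x₀‖ := norm_add_le _ _
          _ ≤ ρ * Real.sqrt (-t) + ρ * Real.sqrt (-t) := add_le_add hz hx
          _ = ρ * (2 * Real.sqrt (-t)) := by ring
          _ ≤ ρ * Real.sqrt (-σ) := mul_le_mul_of_nonneg_left hsq hρ.le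
  -- choose `k` with `4^k t₀ ≤ T`
  obtain ⟨k, hk⟩ : ∃ k : ℕ, 4 ^ k * t₀ ≤ T := by
    obtain ⟨k, hk⟩ := pow_unbounded_of_one_lt (T / t₀) (by norm_num : (1 : ℝ) < 4)
    refine ⟨k, ?_⟩
    have h := (div_lt_iff_of_neg ht₀).1 hk
    linarith
  obtain ⟨t, ht4, htt₀, x, hx, hv⟩ := hiter k
  exact ⟨t, ht4.trans hk, htt₀, x, hx, hv⟩

end Summit.NavierStokesRegularity.NavierStokesRegularity.Theorems.NearExtremalTransiencePerFlow.LocalKatoGap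

end
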